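import Mathlib
import Literature.Analysis.Complex.MontelSCV
import Literature.Analysis.Complex.OsgoodProofs
import Literature.Analysis.FluidPDE.NSLocalAnalyticityRadiusTube
import Literature.Analysis.FunctionSpaces.Complexify
import Summits.NavierStokesRegularity.NavierStokesRegularity.Theorems.CalmPocketDoorDefs
import HarnessLib

/-!
# Door S32 «CalmPocketDoor» (ROUND-30, nsreg-p1), plate Q32 · POCKET → SHELL PROPAGATION OF SMALLNESS

S-door lane of the cell `ns-regularity-ideate` (LEAD ns-s30-p1 g2; texts of record `r30/Sketch32.lean` v2 sha16 d8e333116c9f1838,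
proof plan PLATE-AID-32 v2 Δ2 «SOFT route»; hand ns-sfl-p1 g4 by the LEAD's ruling 2026-08-28T12:13:34Z).  Pure several complex
variables: for tube data `(R, r₀, K₀)` and an aperture `κ ≤ ½`, every target level `δ > 0` on the exterior shell `A_R = {½ ≤ ‖x‖ ≤ R}` is
guaranteed by some calmness level `ε > 0` on ONE pocket `B(x₁, κ)`, `1 ≤ ‖x₁‖ ≤ R/2`, uniformly over all real fields `U₁` on the shell that
are real slices of maps holomorphic on the complex `r₀`-tube over `A_R` and bounded there by `K₀`.

Proof (contradiction + normal families).  If no `ε` works for `(R, r₀, K₀, κ, δ)`, pick violators `U₁ⁿ, x₁ⁿ, Fⁿ, zₙ` with `‖U₁ⁿ‖ ≤ 1/(n+1)` on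
`B(x₁ⁿ, κ)` and `‖U₁ⁿ zₙ‖ > δ`, `zₙ ∈ A_R`.  The tube `T = ⋃_{x ∈ A_R} B(complexify x, r₀)` is OPEN and the complexified shell
`K = complexify '' A_R ⊆ T` is COMPACT, so the tree's several-variable Montel theorem
`Literature.Analysis.Complex.SCV.exists_strictMono_tendstoUniformlyOn_of_norm_le` extracts `Fⁿ ∘ φ → G` UNIFORMLY ON `K` with `G` holomorphic on `T`.
A further subsequence of the pocket centres converges, `x₁^{φψn} → x*` (`1 ≤ ‖x*‖ ≤ R/2`); on the real ball `B(x*, κ/2)` the values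
`Fⁿ(complexify x) = complexify (U₁ⁿ x)` are eventually `≤ 1/(n+1)`, so `G ∘ complexify = 0` there; the real-slice identity principle
`Literature.Analysis.FluidPDE.eqOn_localComplexTube_of_forall_complexify_eq` on the local tube `localComplexTube x* (κ/2) h ⊆ T` gives `G = 0` on a
complex neighbourhood of `complexify x*`; `G` is analytic on `T` (Osgood, `SCV.analyticOnNhd_of_differentiableOn`) and `T` is preconnected
(balls hung on the preconnected `K`; the shell is the image of `sphere × [½, R]`), so `G ≡ 0` on `T` (Mathlib identity theorem) — contradicting
`‖F^{φN}(complexify z_{φN})‖ = ‖U₁^{φN} z_{φN}‖ > δ` against uniform convergence on `K`.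

* `pocketPropagation` — **Q32 = `PocketPropagation` of Sketch32 v2 (:129–132) with `shell` / `cTube` / `HasTubeExtension` δ-UNFOLDED**;
* `pocketPropagation_holds : PocketPropagation` — the same BY NAME against the landed defs file `CalmPocketDoorDefs` (P0, ns-imp-p1 g4).

WHAT THIS IS NOT: not NS regularity, not 0056 — one plate of the door S32, which is a regularity CRITERION conditional on Barker–Prange 2021
Prop. 10; `--supports` stmt-0056 as a helper.
[cite: HormanderSCV1973, §2.2 (Thm 2.2.7, Cor. 2.2.5); GrauertRemmert1977, Kap. VI §1 Satz 4; StreaterWightman1964, §2-3]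
-/

noncomputable section

set_option linter.dupNamespace false

open MeasureTheory Set Function Filter Topology TopologicalSpace Metric
open scoped Topology
open Literature.Analysis Literature.Analysis.FluidPDE
open Literature.Analysis.FunctionSpaces.EuclideanSpace (complexify norm_complexify continuous_complexify)

namespace Summit.NavierStokesRegularity.NavierStokesRegularity.Theorems.CalmPocketDoor

/-- **Q32 · POCKET → SHELL PROPAGATION OF SMALLNESS** (`PocketPropagation` of Sketch32 v2, with `shell R = {½ ≤ ‖x‖ ≤ R}`,
`cTube A r = ⋃_{x ∈ A} B(complexify x, r)` and `HasTubeExtension` UNFOLDED): for tube data `(R, r₀, K₀)`, an aperture `κ ≤ ½` and a target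
level `δ > 0` there is a calmness level `ε > 0` such that every real field on the shell which is the real slice of a map holomorphic on the
`r₀`-tube and bounded by `K₀` there, and which is `≤ ε` on one pocket `B(x₁, κ)`, `1 ≤ ‖x₁‖ ≤ R/2`, is `≤ δ` on the whole shell.
(Contradiction + Montel in several variables + real-slice identity principle + identity theorem on the connected tube.)
[cite: HormanderSCV1973, §2.2 Thm 2.2.7; StreaterWightman1964, §2-3] -/
theorem pocketPropagation :
    ∀ R r₀ K₀ κ δ : ℝ, 2 ≤ R → 0 < r₀ → 0 < K₀ → 0 < κ → κ ≤ 1 / 2 → 0 < δ → ∃ ε : ℝ, 0 < ε ∧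
      ∀ (U₁ : EuclideanSpace ℝ (Fin 3) → EuclideanSpace ℝ (Fin 3)) (x₁ : EuclideanSpace ℝ (Fin 3)),
        (∃ F : EuclideanSpace ℂ (Fin 3) → EuclideanSpace ℂ (Fin 3),
            DifferentiableOn ℂ F (⋃ x ∈ {x : EuclideanSpace ℝ (Fin 3) | 1 / 2 ≤ ‖x‖ ∧ ‖x‖ ≤ R}, ball (complexify x) r₀) ∧
              (∀ z ∈ ⋃ x ∈ {x : EuclideanSpace ℝ (Fin 3) | 1 / 2 ≤ ‖x‖ ∧ ‖x‖ ≤ R}, ball (complexify x) r₀, ‖F z‖ ≤ K₀) ∧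
              ∀ x ∈ {x : EuclideanSpace ℝ (Fin 3) | 1 / 2 ≤ ‖x‖ ∧ ‖x‖ ≤ R}, F (complexify x) = complexify (U₁ x)) →
        1 ≤ ‖x₁‖ → ‖x₁‖ ≤ R / 2 → (∀ x ∈ ball x₁ κ, ‖U₁ x‖ ≤ ε) →
          ∀ x ∈ {x : EuclideanSpace ℝ (Fin 3) | 1 / 2 ≤ ‖x‖ ∧ ‖x‖ ≤ R}, ‖U₁ x‖ ≤ δ := by
  intro R r₀ K₀ κ δ hR hr₀ _hK₀ hκ hκ2 hδ
  -- the shell `S`, its complex tube `T`, the complexified shell `K`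
  set S : Set (EuclideanSpace ℝ (Fin 3)) := {x | 1 / 2 ≤ ‖x‖ ∧ ‖x‖ ≤ R} with hS
  set T : Set (EuclideanSpace ℂ (Fin 3)) := ⋃ x ∈ S, ball (complexify x) r₀ with hT
  have hTo : IsOpen T := isOpen_biUnion fun _ _ => isOpen_ball
  have hSc : IsCompact S :=
    (isCompact_closedBall (0 : EuclideanSpace ℝ (Fin 3)) R).of_isClosed_subset
      ((isClosed_le continuous_const continuous_norm).inter (isClosed_le continuous_norm continuous_const))
      fun x hx => mem_closedBall_zero_iff.2 hx.2
  have hKc : IsCompact (complexify '' S) := hSc.image continuous_complexify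
  have hKT : complexify '' S ⊆ T := by
    rintro _ ⟨x, hx, rfl⟩
    exact mem_biUnion hx (mem_ball_self hr₀)
  -- the shell is preconnected (image of `sphere × [½, R]`) and non-empty, hence so is the tube
  have hSpc : IsPreconnected S := by
    have hrk : 1 < Module.rank ℝ (EuclideanSpace ℝ (Fin 3)) := by
      rw [← Module.finrank_eq_rank, finrank_euclideanSpace_fin]
      norm_num
    have h1 : IsPreconnected (sphere (0 : EuclideanSpace ℝ (Fin 3)) 1 ×ˢ Icc (1 / 2 : ℝ) R) :=
      (isPreconnected_sphere hrk 0 1).prod isPreconnected_Icc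
    have h2 : S = (fun q : EuclideanSpace ℝ (Fin 3) × ℝ => q.2 • q.1) '' (sphere (0 : EuclideanSpace ℝ (Fin 3)) 1 ×ˢ Icc (1 / 2 : ℝ) R) := by
      apply Subset.antisymm
      · intro x hx
        have hnx : 0 < ‖x‖ := by linarith [hx.1]
        refine ⟨(‖x‖⁻¹ • x, ‖x‖), ⟨?_, hx.1, hx.2⟩, ?_⟩
        · rw [mem_sphere_zero_iff_norm, norm_smul, norm_inv, norm_norm, inv_mul_cancel₀ hnx.ne']
        · simp only [smul_smul, mul_inv_cancel₀ hnx.ne', one_smul]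
      · rintro _ ⟨⟨e, t⟩, ⟨he, ht⟩, rfl⟩
        rw [mem_sphere_zero_iff_norm] at he
        have hte : ‖t • e‖ = t := by
          rw [norm_smul, he, mul_one, Real.norm_of_nonneg (by linarith [ht.1])]
        exact ⟨by rw [hte]; exact ht.1, by rw [hte]; exact ht.2⟩
    rw [h2]
    exact h1.image _ (continuous_snd.smul continuous_fst).continuousOn
  have hKpc : IsPreconnected (complexify '' S) := hSpc.image _ continuous_complexify.continuousOn
  have hSne : S.Nonempty := by
    obtain ⟨x0, hx0⟩ := exists_norm_eq (EuclideanSpace ℝ (Fin 3)) zero_le_one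
    exact ⟨x0, by rw [hx0]; norm_num, by rw [hx0]; linarith⟩
  have hTpc : IsPreconnected T := by
    have hTeq : T = ⋃ x : S, (ball (complexify (x : EuclideanSpace ℝ (Fin 3))) r₀ ∪ complexify '' S) := by
      apply Subset.antisymm
      · intro w hw
        obtain ⟨x, hx, hw'⟩ := mem_iUnion₂.1 hw
        exact mem_iUnion.2 ⟨⟨x, hx⟩, Or.inl hw'⟩
      · intro w hw
        obtain ⟨⟨x, hx⟩, hw'⟩ := mem_iUnion.1 hw
        rcases hw' with h' | h'
        · exact mem_biUnion hx h'
        · exact hKT h'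
    rw [hTeq]
    obtain ⟨x0, hx0⟩ := hSne
    refine isPreconnected_iUnion ⟨complexify x0, mem_iInter.2 fun i => Or.inr (mem_image_of_mem _ hx0)⟩ fun i => ?_
    exact IsPreconnected.union (complexify (i : EuclideanSpace ℝ (Fin 3))) (mem_ball_self hr₀) (mem_image_of_mem _ i.2)
      (convex_ball _ _).isPreconnected hKpc
  -- suppose no `ε` works: violators at every level `1/(n+1)`
  by_contra hneg
  push Not at hneg
  have hseq : ∀ n : ℕ, ∃ (U₁ : EuclideanSpace ℝ (Fin 3) → EuclideanSpace ℝ (Fin 3)) (x₁ : EuclideanSpace ℝ (Fin 3))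
      (F : EuclideanSpace ℂ (Fin 3) → EuclideanSpace ℂ (Fin 3)) (z : EuclideanSpace ℝ (Fin 3)),
      DifferentiableOn ℂ F T ∧ (∀ w ∈ T, ‖F w‖ ≤ K₀) ∧ (∀ x ∈ S, F (complexify x) = complexify (U₁ x)) ∧
        1 ≤ ‖x₁‖ ∧ ‖x₁‖ ≤ R / 2 ∧ (∀ x ∈ ball x₁ κ, ‖U₁ x‖ ≤ 1 / ((n : ℝ) + 1)) ∧ z ∈ S ∧ δ < ‖U₁ z‖ := by
    intro n
    obtain ⟨U₁, x₁, ⟨F, hFd, hFb, hFr⟩, h1, h2, hsmall, z, hz, hbig⟩ := hneg (1 / ((n : ℝ) + 1)) (by positivity)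
    exact ⟨U₁, x₁, F, z, hFd, hFb, hFr, h1, h2, hsmall, hz, hbig⟩
  choose U xc F z hFd hFb hFr hx1 hx2 hsmall hzS hbig using hseq
  -- Montel on the tube, uniform convergence on the compact complexified shell
  obtain ⟨G, φ, hφ, hGd, -, hunif⟩ :=
    Literature.Analysis.Complex.SCV.exists_strictMono_tendstoUniformlyOn_of_norm_le hTo hKc hKT hFd hFb
  -- a convergent subsequence of pocket centres
  obtain ⟨xs, -, ψ, hψ, hlimx⟩ := (isCompact_closedBall (0 : EuclideanSpace ℝ (Fin 3)) (R / 2)).tendsto_subseq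
    (fun n => mem_closedBall_zero_iff.2 (hx2 (φ n)))
  have hxs1 : 1 ≤ ‖xs‖ := ge_of_tendsto' hlimx.norm fun n => hx1 (φ (ψ n))
  have hxs2 : ‖xs‖ ≤ R / 2 := le_of_tendsto' hlimx.norm fun n => hx2 (φ (ψ n))
  have hxsS : xs ∈ S := ⟨by linarith, by linarith⟩
  -- real points near `xs` are in the shell
  have hnear : ∀ x : EuclideanSpace ℝ (Fin 3), dist x xs < κ / 2 → x ∈ S := by
    intro x hx
    rw [dist_eq_norm] at hx
    have h1 : ‖xs‖ - ‖x - xs‖ ≤ ‖x‖ := by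
      have := norm_sub_norm_le xs x
      rw [← norm_neg (xs - x), neg_sub] at this
      linarith
    have h2 : ‖x‖ ≤ ‖x - xs‖ + ‖xs‖ := norm_le_norm_sub_add x xs
    exact ⟨by linarith, by linarith⟩
  -- the Montel limit vanishes at the real points of `B(xs, κ/2)`
  have hGzero : ∀ x ∈ ball xs (κ / 2), G (complexify x) = 0 := by
    intro x hx
    rw [mem_ball] at hx
    have hxS : x ∈ S := hnear x hx
    have hev : ∀ᶠ n in atTop, dist (xc (φ (ψ n))) xs < κ / 2 :=
      (Metric.tendsto_nhds.1 hlimx) (κ / 2) (by positivity)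
    have hconv : Tendsto (fun n => F (φ (ψ n)) (complexify x)) atTop (𝓝 (G (complexify x))) :=
      (hunif.tendsto_at (mem_image_of_mem _ hxS)).comp hψ.tendsto_atTop
    have hb : ∀ᶠ n in atTop, ‖F (φ (ψ n)) (complexify x)‖ ≤ 1 / (((φ (ψ n) : ℕ) : ℝ) + 1) := by
      filter_upwards [hev] with n hn
      rw [hFr _ x hxS, norm_complexify]
      refine hsmall _ x ?_
      rw [mem_ball]
      calc dist x (xc (φ (ψ n))) ≤ dist x xs + dist xs (xc (φ (ψ n))) := dist_triangle _ _ _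
        _ < κ / 2 + κ / 2 := by rw [dist_comm xs]; exact add_lt_add hx hn
        _ = κ := by ring
    have h0 : Tendsto (fun n => 1 / (((φ (ψ n) : ℕ) : ℝ) + 1)) atTop (𝓝 0) :=
      tendsto_one_div_add_atTop_nhds_zero_nat.comp ((hφ.comp hψ).tendsto_atTop)
    have hnorm : Tendsto (fun n => ‖F (φ (ψ n)) (complexify x)‖) atTop (𝓝 0) :=
      squeeze_zero' (Eventually.of_forall fun n => norm_nonneg _) hb h0
    exact norm_eq_zero.1 (tendsto_nhds_unique hconv.norm hnorm)
  -- hence `G = 0` on a local complex tube about `complexify xs`, which sits inside `T`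
  set h : ℝ := min (κ / 2) r₀ with hh
  have hh0 : 0 < h := lt_min (by positivity) hr₀
  have hL : localComplexTube xs (κ / 2) h ⊆ T := by
    rintro w ⟨a, b, ha, hb, rfl⟩
    refine mem_biUnion (hnear a ha) ?_
    rw [mem_ball, dist_eq_norm, add_sub_cancel_left, norm_smul, Complex.norm_I, one_mul, norm_complexify]
    exact hb.trans_le (min_le_right _ _)
  have hGL : EqOn G (fun _ => 0) (localComplexTube xs (κ / 2) h) :=
    eqOn_localComplexTube_of_forall_complexify_eq (hGd.mono hL) (differentiableOn_const _) fun x hx => hGzero x hx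
  have hev0 : G =ᶠ[𝓝 (complexify xs)] 0 := by
    have hmem : complexify xs ∈ localComplexTube xs (κ / 2) h :=
      complexify_mem_localComplexTube hh0 (by rw [dist_self]; positivity)
    exact Filter.eventuallyEq_of_mem ((isOpen_localComplexTube xs (κ / 2) h).mem_nhds hmem) hGL
  -- identity theorem on the preconnected tube: `G ≡ 0`
  have hGa : AnalyticOnNhd ℂ G T := Literature.Analysis.Complex.SCV.analyticOnNhd_of_differentiableOn hGd hTo
  have hG0 : EqOn G 0 T := hGa.eqOn_zero_of_preconnected_of_eventuallyEq_zero hTpc (hKT (mem_image_of_mem _ hxsS)) hev0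
  -- contradiction with the violators along the Montel subsequence
  obtain ⟨N, hN⟩ := ((Metric.tendstoUniformlyOn_iff.1 hunif) (δ / 2) (by positivity)).exists
  have hzK : complexify (z (φ N)) ∈ complexify '' S := mem_image_of_mem _ (hzS _)
  have h1 := hN _ hzK
  rw [hG0 (hKT hzK), Pi.zero_apply, dist_comm, dist_zero_right, hFr _ _ (hzS _), norm_complexify] at h1
  linarith [hbig (φ N)]

/-- **Q32 BY NAME: `PocketPropagation` holds** (the δ-unfolded `pocketPropagation` read through the defs of `CalmPocketDoorDefs`).
[cite: HormanderSCV1973, §2.2 Thm 2.2.7] -/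
theorem pocketPropagation_holds : PocketPropagation :=
  pocketPropagation

end Summit.NavierStokesRegularity.NavierStokesRegularity.Theorems.CalmPocketDoor

end
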